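import Summits.QuantumFields.YangMills.Theorems.BalabanUVNodesN15AtSpineCarriersBackground
import Summits.QuantumFields.YangMills.Theorems.BalabanUVNodesN15VectorPieceV1Gauge

/-!
# YM-DAG node N15 (= NE2) AT THE RATE CARRIERS OF RECORD, RE-KEYED WITH THE GAUGE FIELD ITSELF AS THE DATUM OF THE PRINT's `V′₁(A)`: the K4 stub
# `YMDAG.UVSplit.S_N15 RRec` closed over every rate-carrier predicate whose NE2 component carries the realised GAUGE-DATUM `V′₁` family of the U = 1 vector
# piece ⊗ 1_𝔤 ((3.35) = unit-scale C² letters of ONE `A′`, consumed) — the OPERATOR layer HYPOTHESIS-FREE by name, the site-kernel and unit-lattice layers displayed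

Track A of `YM-PLAN.md` (cell `pub-ymgap`, HUMAN RULING D-0062), node **N15**; typed by seat `pub-ymgap-dag-n15-c` (generation g3) as the spine-carrier faces of its
(V4) chain (`…N15BackgroundV1Gauge`, `…N15BackgroundV1GaugeByName`, `…N15VectorPieceV1Gauge`).  Shape twin and import: this seat's (g0)
`BalabanUVNodesN15AtSpineCarriersBackground` and (g3) `BalabanUVNodesN15AtSpineCarriersV1` (same namespace, nothing restated).  Producer consumed BY NAME: this seat's
`VectorPiece.ne2PlusOperator_vectorPiece_v1G` (the print's `V′₁(A)` with the gauge field `A′` itself as the datum, forward AND backward derived pieces).  Kernel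
bookkeeping: 0 `def`, 0 `sorry`, standard axioms.  COUNT-NEUTRAL; `--supports` the K3′ item `SpineGivenEndpointR12` (stmt-QuantumFields-19908, helper).

THE STUB.  `S_N15 RRec := ∀ F D g₀ os R, RRec F D g₀ os R → N15At R.ne2`, `N15At c := NE2PlusOperator c.c35 c.pi c.Kop ∧ NE2PlusSite 4 c.p c.c35 c.pi c.Ksite ∧
NE2PlusUnit c.c35 c.pi c.Kunit c.inΛ c.unitDist`.

WHAT THIS MODULE IS.
* §1 THE NODE FACE WITH THE GAUGE DATUM LIVE: **`n15At_vectorPiece_v1G_of_layers`** — for `d + 1 ≥ 2`, `L ≥ 1`, `c₃₅ > 0`, coordinates `e : 𝔄 ≃L[ℝ] ℝ^ι`, on the NE2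
  carriers indexed by the sized family `VecIndexS d L` whose paired instances ∕ operator kernels are the realised gauge-datum family (`v1GVecInstance`,
  `v1GVecFamily4`) on the product carriers `X × ι`, `N15At` follows from the site-kernel and unit-lattice layers ALONE — the operator conjunct is the producer's theorem.
* §2 (W2) CLOSER, refinement-generic: **`s_N15_of_v1GReading`**.
* §3 GUARD: `not_n15At_iff_site_or_unit_fails_v1GG` — on the gauge-datum carriers `N15At` FAILS iff the site OR the unit layer fails.

HONEST FRAMING.  NE2 is NOT PRINTED beyond King's scalar template and NOT PROVED for Bałaban's `G(U)`.  What enters hypothesis-free is the operator layer of the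
LINEAR (U = 1) vector single-scale piece of [B5]∕[B6]∕King (4.42) tensored with `1_𝔤`, dressed by the print's FIRST-ORDER species `V′₁(A)` of (3.52) with ONE gauge
field `A′` as the datum ((3.35) = OUR unit-scale reading of the printed C² pair (3.35)–(3.36); transport = fibrewise mean, linearised (C3); the coarse triple = mean of the fine triple); NOT the (C3)
nonlinear transport, NOT the second-order `F′_{1,k}` term, NOT `V′₂` of (3.55)–(3.62), NOT the multiscale carrier of NODE 00; the SITE-KERNEL and UNIT-LATTICE layers of `N15At` remain DISPLAYED (no
producer with the background live exists in the tree).  N15 is NOT discharged (0∕1 at every record); typed 28∕28, discharged count untouched; one finite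
four-torus programme at fixed `ε` — NOT ℝ⁴, NOT infinite volume, NOT OS, NOT a mass gap, NOT Clay.  Restate-immune.  No decl below carries a cite tag.
-/

noncomputable section

open Finset

namespace Summit.QuantumFields.YangMills.Theorems.N15AtSpineCarriers

open Literature.MathematicalPhysics.QuantumFieldTheory.Balaban1983to89
open Literature.MathematicalPhysics.QuantumFieldTheory.Balaban1983to89.T4Continuum
open Literature.MathematicalPhysics.QuantumFieldTheory.Balaban1983to89.B9 (SiteKernel)
open Literature.MathematicalPhysics.QuantumFieldTheory.Balaban1983to89.T4EtaRate (PairedInstance NE2PlusOperator NE2PlusSite NE2PlusUnit)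
open Summit.QuantumFields.YangMills.BalabanUVNodes.N15.VectorPiece (VecIndexS v1GVecInstance v1GVecFamily4 ne2PlusOperator_vectorPiece_v1G)
open YMDAG.UVSplit (Datum NE2Carriers RateCarriers RateRecordPred N15At RatesAt S_N15)

variable {N : ℕ} [NeZero N] {d : ℕ} {L : ℕ} [NeZero L] {ι : Type} [Fintype ι] [DecidableEq ι]
  {𝔄 : Type} [NormedRing 𝔄] [NormedAlgebra ℝ 𝔄] [CompleteSpace 𝔄] (e : 𝔄 ≃L[ℝ] (ι → ℝ))

/-! ## §1 The node face with the gauge datum live: `N15At` from the site and unit layers alone -/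

section Faces

/-- **`N15At` WITH THE PRINT's OWN `V′₁(A)` LIVE, FROM THE SITE AND UNIT LAYERS ALONE.**  On the NE2 carriers indexed by the sized family, with paired instances
`v1GVecInstance` (configurations `(A⁺, A⁻, W)`, (3.35) = the letter pair on each field in the norm of `𝔄`, guard = the index's `M`) and operator kernels
`v1GVecFamily4` (V2's constructed pair with `V′₁ = M_c + Σ_μ[M_{a⁺_μ}∇⁺_μ + M_{a⁻_μ}∇⁻_μ]` fed with the -a pieces ⊗ 1_𝔤, forward AND backward derived pieces),
the operator conjunct is `VectorPiece.ne2PlusOperator_vectorPiece_v1` (hypothesis-free for `d + 1 ≥ 2`, `L ≥ 1`, `c₃₅ > 0`); `N15At` follows from the two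
displayed layers. [bookkeeping] -/
theorem n15At_vectorPiece_v1G_of_layers (hd : 1 ≤ d) (hL : 1 ≤ L) {c35 : ℝ} (hc35 : 0 < c35) (p : ℝ)
    (Ksite Kunit : ∀ j : VecIndexS d L, SiteKernel (v1GVecInstance (d := d) 𝔄 ι L hL j).gc (v1GVecInstance (d := d) 𝔄 ι L hL j).Bf)
    (inΛ : ∀ j : VecIndexS d L, (v1GVecInstance (d := d) 𝔄 ι L hL j).gc.Site → Prop)
    (unitDist : ∀ j : VecIndexS d L, (v1GVecInstance (d := d) 𝔄 ι L hL j).gc.Site → (v1GVecInstance (d := d) 𝔄 ι L hL j).gc.Site → ℝ)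
    (hsite : NE2PlusSite 4 p c35 (v1GVecInstance (d := d) 𝔄 ι L hL) Ksite)
    (hunit : NE2PlusUnit c35 (v1GVecInstance (d := d) 𝔄 ι L hL) Kunit inΛ unitDist) :
    N15At { I := VecIndexS d L, c35 := c35, p := p, pi := v1GVecInstance (d := d) 𝔄 ι L hL, Kop := v1GVecFamily4 (d := d) 𝔄 ι e L hL,
            Ksite := Ksite, Kunit := Kunit, inΛ := inΛ, unitDist := unitDist } :=
  ⟨ne2PlusOperator_vectorPiece_v1G (d := d) e hd hL c35 hc35, hsite, hunit⟩

end Faces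

/-! ## §2 (W2) closer: `S_N15` for every rate-record predicate whose NE2 component IS the gauge-datum family plus the two remaining layers -/

section Closers

/-- **`S_N15` FOR EVERY GAUGE-DATUM READING** (the carriers of `n15At_vectorPiece_v1G_of_layers`): if `RRec` hands, with every bundle `R` it pins, an identification of
`R.ne2` with those carriers (any `c₃₅ > 0`, exponent `p`, site ∕ unit kernels, region, unit distance) together with the site-kernel and unit-lattice layers on
them, then `S_N15 RRec` — the operator layer is NOT a hypothesis. [bookkeeping] -/
theorem s_N15_of_v1GReading (hd : 1 ≤ d) (hL : 1 ≤ L) (RRec : RateRecordPred N)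
    (hread : ∀ (F : T4Family) (D : Datum F N) (g₀ : ℕ → ℝ) (os : List (ULoop F)) (R : RateCarriers N), RRec F D g₀ os R →
      ∃ (c35 p : ℝ) (Ksite Kunit : ∀ j : VecIndexS d L, SiteKernel (v1GVecInstance (d := d) 𝔄 ι L hL j).gc (v1GVecInstance (d := d) 𝔄 ι L hL j).Bf)
        (inΛ : ∀ j : VecIndexS d L, (v1GVecInstance (d := d) 𝔄 ι L hL j).gc.Site → Prop)
        (unitDist : ∀ j : VecIndexS d L, (v1GVecInstance (d := d) 𝔄 ι L hL j).gc.Site → (v1GVecInstance (d := d) 𝔄 ι L hL j).gc.Site → ℝ),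
        0 < c35 ∧
        R.ne2 = { I := VecIndexS d L, c35 := c35, p := p, pi := v1GVecInstance (d := d) 𝔄 ι L hL, Kop := v1GVecFamily4 (d := d) 𝔄 ι e L hL,
                  Ksite := Ksite, Kunit := Kunit, inΛ := inΛ, unitDist := unitDist } ∧
        NE2PlusSite 4 p c35 (v1GVecInstance (d := d) 𝔄 ι L hL) Ksite ∧ NE2PlusUnit c35 (v1GVecInstance (d := d) 𝔄 ι L hL) Kunit inΛ unitDist) :
    S_N15 RRec := by
  intro F D g₀ os R hR
  obtain ⟨c35, p, Ksite, Kunit, inΛ, unitDist, hc35, hne2, hsite, hunit⟩ := hread F D g₀ os R hR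
  rw [hne2]
  exact n15At_vectorPiece_v1G_of_layers e hd hL hc35 p Ksite Kunit inΛ unitDist hsite hunit

end Closers

/-! ## §3 Guard: on the gauge-datum carriers the operator layer is never the reason `N15At` fails -/

section Guard

/-- **ON THE GAUGE-DATUM CARRIERS `N15At` FAILS IFF THE SITE OR THE UNIT LAYER FAILS** (the operator layer holds by `VectorPiece.ne2PlusOperator_vectorPiece_v1`): the honest
residue of N15 on this family is the pair of displayed layers. [bookkeeping] -/
theorem not_n15At_iff_site_or_unit_fails_v1G (hd : 1 ≤ d) (hL : 1 ≤ L) {c35 : ℝ} (hc35 : 0 < c35) (p : ℝ)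
    (Ksite Kunit : ∀ j : VecIndexS d L, SiteKernel (v1GVecInstance (d := d) 𝔄 ι L hL j).gc (v1GVecInstance (d := d) 𝔄 ι L hL j).Bf)
    (inΛ : ∀ j : VecIndexS d L, (v1GVecInstance (d := d) 𝔄 ι L hL j).gc.Site → Prop)
    (unitDist : ∀ j : VecIndexS d L, (v1GVecInstance (d := d) 𝔄 ι L hL j).gc.Site → (v1GVecInstance (d := d) 𝔄 ι L hL j).gc.Site → ℝ) :
    ¬ N15At { I := VecIndexS d L, c35 := c35, p := p, pi := v1GVecInstance (d := d) 𝔄 ι L hL, Kop := v1GVecFamily4 (d := d) 𝔄 ι e L hL,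
              Ksite := Ksite, Kunit := Kunit, inΛ := inΛ, unitDist := unitDist } ↔
      ¬ NE2PlusSite 4 p c35 (v1GVecInstance (d := d) 𝔄 ι L hL) Ksite ∨ ¬ NE2PlusUnit c35 (v1GVecInstance (d := d) 𝔄 ι L hL) Kunit inΛ unitDist := by
  constructor
  · intro h
    by_cases hs : NE2PlusSite 4 p c35 (v1GVecInstance (d := d) 𝔄 ι L hL) Ksite
    · by_cases hu : NE2PlusUnit c35 (v1GVecInstance (d := d) 𝔄 ι L hL) Kunit inΛ unitDist
      · exact absurd (n15At_vectorPiece_v1G_of_layers e hd hL hc35 p Ksite Kunit inΛ unitDist hs hu) h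
      · exact Or.inr hu
    · exact Or.inl hs
  · rintro (hs | hu) ⟨_, hsite, hunit⟩
    · exact hs hsite
    · exact hu hunit

end Guard

end Summit.QuantumFields.YangMills.Theorems.N15AtSpineCarriers

end
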